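import Summits.HodgeConjecture.HodgeConjecture.Theorems.Ring2AbelianAllAndreFibreClassDivisionRungs
import Summits.HodgeConjecture.HodgeConjecture.Theorems.Ring2AbelianAllAndreFibreClassDivisionExact
import HarnessLib

/-!
# Ring 2 · sub-cell AbelianAll (ALL ABELIAN VARIETIES), André axis, part XXIX-f — THE ABSOLUTE STATEMENT BEHIND PART XXIX:
# under "hom ≡ num" in two bidegrees, the algebraic classes of a smooth projective variety are SATURATED FOR DIVISION BY ANY
# ALGEBRAIC CLASS; (Div) and Grothendieck's `A(X, η)` are its two instances; (N_p f) = (Div) + "every fibre-class multiple is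
# algebraic"; the variational statement for algebraic classes, packaged

HONEST FRAMING (page 1, verbatim): **research route, not a corollary; conditional on HC_CM plus one named
minimal statement.** Cell line: research route conditional on HC_CM; not a corollary; Q11.4-sentence-2
already refuted in dim ≥ 3. Nothing in this file proves a case of the Hodge conjecture for an abelian variety. `HC_CM` does NOT
occur in this file; item `Theses.RankFourFaces.CMToAbelian` (stmt-HodgeConjecture-16267) OPEN and not closed here. Seat
`pub-hodge-ring2-ab-andre-2`, gen 21; addendum to parts XXIX-a…e (`Ring2AbelianAllAndreFibreClassDivision*`).

## What is proved (theorems only; no definition, no named fact, no sorry)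

§1 THE ABSOLUTE STATEMENT. `X` smooth projective of dimension `n`, `G ∈ N^g(X)` ANY algebraic class, `p + g + q = n`:
`cupProduct_cupProduct_eq_cupProduct_cupProduct` (`(G ∪ a) ∪ w = a ∪ (G ∪ w)`, even degrees) and
**`exists_mem_algebraicClasses_cupProduct_eq_of_nondegenerate`** — if the cup pairing `N^p(X) × N^{g+q}(X) → H^{2n}` has
trivial RIGHT kernel and `N^{p+g}(X) × N^q(X) → H^{2n}` trivial LEFT kernel (two instances of `D(X)`), then
`N^{p+g}(X) ∩ (G ∪ H^{2p}(X(ℂ); ℂ)) = G ∪ N^p(X)`: **an algebraic class divisible by `G` is divisible by `G` within algebraic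
classes** (`cupProduct_mem_algebraicClasses_iff_of_nondegenerate`). INSTANCES: `G = [𝒳_t]` on the total space of a pencil is
part XXIX-a's division (there followed by Deligne's kernel identity); `G = η^{n-2p}` is the surjectivity clause of Grothendieck's
`A(X, η)` (Kleiman's `D ⟹ A`, in the tree as seat ab-andre-1's `standardConjectureA_of_cupPairing_nondegenerate`). As in XXIX-a
only the weaker hypotheses restricted to `G`-divisible classes are used.
§2 (compact abelian pencils) **`algebraicInvariantClassesAt_iff_fibreClassDivisionAt_and_range_le`**: (N_p f)(t) ⟺ Div[t, p] ∧
`L_t H^{2p}(𝒳) ⊆ N^{p+1}(𝒳)` — the idempotent package of part XXVIII (= (N_p f)(t), XXVIII-d) is EXACTLY division plus "every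
fibre-class multiple `x ∪ [𝒳_t]`, `x ∈ H^{2p}(𝒳(ℂ); ℂ)`, is algebraic"; so the habitat clause of parts XXVIII-b/f, granted (Div),
reads on the total space: `[𝒳_t] ∪ H^{2p}(𝒳) ⊆ N^{p+1}(𝒳)`.
§3 (every smooth projective family over a smooth projective base) the variational statement PACKAGED:
`map_fiberι_mem_algebraicClasses_of_comap_le_sup_family` (a lift at `t` makes a class algebraic on `𝒳_t` algebraic on every
fibre), **`map_fiberι_mem_algebraicClasses_of_standardConjectureA_family`** (`A(𝒳, η)` for the total space ⟹ a global class
algebraic on ONE fibre is algebraic on EVERY fibre), `map_fiberι_mem_algebraicClasses_of_curveBase_of_relDim_le_three`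
(unconditionally for families of relative dimension `≤ 3` over a curve, part XXIX-d).

## Honest status

Nothing here is progress on `HC_AV`; §1 is elementary linear algebra over `D(X)` (recorded because it is the common source of
(Div) and of `D ⟹ A`, not as a claim of novelty); no node is born; nothing is minimal.

References: Kleiman1968AlgebraicCycles (§3, Cor. 3.9); Grothendieck1968 (§3 p. 196); Lieberman1968 (Thm. 1); Andre1996Motifs (Thm. 0.5,
§5.1); Abdulali1994FamiliesAV (Thm. 5.5); Milne2020HodgeClassesAV (Prop. 1); HatcherAT2002 (§3.2 Thm. 3.11, Prop. 3.10, §3.3 Prop. 3.38);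
DeligneHodgeII1971 (Thm. 4.1.1).
-/

noncomputable section

set_option linter.dupNamespace false

namespace Summit.HodgeConjecture.HodgeConjecture.Ring2.AbelianAll

open CategoryTheory AlgebraicGeometry
open Literature.AlgebraicGeometry Literature.AlgebraicGeometry.Motives
open Literature.AlgebraicGeometry.HodgeTheory
open Literature.AlgebraicTopology.SingularHomology (singularCohomology cupProduct cupProduct_gradedComm_holds cupProduct_assoc)
open Summit.HodgeConjecture.HodgeConjecture
open Summit.HodgeConjecture.HodgeConjecture.Theorems (fulton1998_map_mem_algebraicClasses_holds Voisin2003_cupProduct_algebraicClasses_holds)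

/-! ## §1 The absolute statement: division by an algebraic class under hom ≡ num -/

section Absolute

variable {n : ℕ} {X : SchemeOver ℂ}

/-- **`(G ∪ a) ∪ w = a ∪ (G ∪ w)`** for classes of even degrees `2g, 2p, 2q` (associativity and graded commutativity of the cup
product; all signs are `+1`). [cite: HatcherAT2002, §3.2 Thm. 3.11 and Prop. 3.10] -/
theorem cupProduct_cupProduct_eq_cupProduct_cupProduct {g p q s : ℕ} (hs : 2 * (g + p) + 2 * q = s)
    (G : complexBetti X (2 * g)) (a : complexBetti X (2 * p)) (w : complexBetti X (2 * q)) :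
    cupProduct hs (cupProduct (show 2 * g + 2 * p = 2 * (g + p) by omega) G a) w =
      cupProduct (show 2 * p + 2 * (g + q) = s by omega) a (cupProduct (show 2 * g + 2 * q = 2 * (g + q) by omega) G w) := by
  rw [cupProduct_assoc (show 2 * g + 2 * p = 2 * (g + p) by omega) (show 2 * p + 2 * q = 2 * (p + q) by omega) hs
      (show 2 * g + 2 * (p + q) = s by omega) G a w,
    cupProduct_gradedComm_holds ℂ (ComplexPoints X) (show 2 * p + 2 * (g + q) = s by omega)
      (show 2 * (g + q) + 2 * p = s by omega) a, Even.neg_one_pow ⟨2 * p * (g + q), by ring⟩, one_smul,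
    cupProduct_assoc (show 2 * g + 2 * q = 2 * (g + q) by omega) (show 2 * q + 2 * p = 2 * (p + q) by omega)
      (show 2 * (g + q) + 2 * p = s by omega) (show 2 * g + 2 * (p + q) = s by omega) G w a,
    cupProduct_gradedComm_holds ℂ (ComplexPoints X) (show 2 * q + 2 * p = 2 * (p + q) by omega)
      (show 2 * p + 2 * q = 2 * (p + q) by omega) w a, Even.neg_one_pow ⟨2 * q * p, by ring⟩, one_smul]

/-- **DIVISION BY AN ALGEBRAIC CLASS UNDER HOM ≡ NUM.** `X` smooth projective of dimension `n`, `G ∈ N^g(X)` an algebraic class,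
`p + g + q = n`. Assume (i) every `G ∪ w`, `w ∈ N^q(X)`, cup-orthogonal to `N^p(X)` vanishes (right kernel of
`N^p × N^{g+q} → H^{2n}` on `G`-divisible classes) and (ii) every ALGEBRAIC `G ∪ x`, `x ∈ H^{2p}(X(ℂ); ℂ)`, cup-orthogonal to
`N^q(X)` vanishes (left kernel of `N^{p+g} × N^q` on `G`-divisible classes). Then every `x` with `G ∪ x` algebraic has
`G ∪ x = G ∪ x'` with `x'` ALGEBRAIC. Proof: bi-orthogonality (part XXIX-a §1, left non-degeneracy only) inside
`N^{p+g} ∩ Im(G ∪ ·)` against `N^q`, with `⟪G ∪ a, w⟫ = ⟪a, G ∪ w⟫`. [cite: Kleiman1968AlgebraicCycles, §3 (D(X)) and Cor. 3.9]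
[cite: Grothendieck1968, §3 p. 196] -/
theorem exists_mem_algebraicClasses_cupProduct_eq_of_nondegenerate (hX : IsSmoothProjective n X) {g p q : ℕ}
    (hpgq : p + g + q = n) {G : complexBetti X (2 * g)} (hG : G ∈ algebraicClasses X g)
    (hNum₁ : ∀ w ∈ algebraicClasses X q,
      (∀ a ∈ algebraicClasses X p, cupProduct (show 2 * p + 2 * (g + q) = 2 * n by omega) a
          (cupProduct (show 2 * g + 2 * q = 2 * (g + q) by omega) G w) = 0) →
        cupProduct (show 2 * g + 2 * q = 2 * (g + q) by omega) G w = 0)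
    (hNum₂ : ∀ x : complexBetti X (2 * p),
      cupProduct (show 2 * g + 2 * p = 2 * (g + p) by omega) G x ∈ algebraicClasses X (g + p) →
      (∀ w ∈ algebraicClasses X q, cupProduct (show 2 * (g + p) + 2 * q = 2 * n by omega)
          (cupProduct (show 2 * g + 2 * p = 2 * (g + p) by omega) G x) w = 0) →
        cupProduct (show 2 * g + 2 * p = 2 * (g + p) by omega) G x = 0)
    {x : complexBetti X (2 * p)}
    (hx : cupProduct (show 2 * g + 2 * p = 2 * (g + p) by omega) G x ∈ algebraicClasses X (g + p)) :
    ∃ x' ∈ algebraicClasses X p, cupProduct (show 2 * g + 2 * p = 2 * (g + p) by omega) G x' =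
      cupProduct (show 2 * g + 2 * p = 2 * (g + p) by omega) G x := by
  haveI : Module.Finite ℂ (complexBetti X (2 * q)) := finite_complexBetti hX _
  set L : complexBetti X (2 * p) →ₗ[ℂ] complexBetti X (2 * (g + p)) :=
    cupProduct (show 2 * g + 2 * p = 2 * (g + p) by omega) G with hL
  have hLalg : ∀ y ∈ algebraicClasses X p, L y ∈ algebraicClasses X (g + p) := fun y hy ↦
    Voisin2003_cupProduct_algebraicClasses_holds hX hG hy
  have hmem : L x ∈ (algebraicClasses X p).map L := by
    have hline : Module.finrank ℂ (complexBetti X (2 * n)) = 1 := finrank_complexBetti_two_mul_eq_one hX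
    refine mem_of_forall_orthogonal_of_left_nondegenerate'
      (cupProduct (show 2 * (g + p) + 2 * q = 2 * n by omega)) hline
      (A := algebraicClasses X (g + p) ⊓ LinearMap.range L) (A' := algebraicClasses X q)
      (fun a ha hab ↦ ?_) ?_ (Submodule.mem_inf.2 ⟨hx, LinearMap.mem_range_self L x⟩) fun w hw hwV ↦ ?_
    · obtain ⟨ha₁, ha₂⟩ := Submodule.mem_inf.1 ha
      obtain ⟨x₀, rfl⟩ := LinearMap.mem_range.1 ha₂
      exact hNum₂ x₀ ha₁ hab
    · rintro _ ⟨y, hy, rfl⟩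
      exact Submodule.mem_inf.2 ⟨hLalg y hy, LinearMap.mem_range_self L y⟩
    · have hGw : cupProduct (show 2 * g + 2 * q = 2 * (g + q) by omega) G w = 0 := by
        refine hNum₁ w hw fun a ha ↦ ?_
        rw [← cupProduct_cupProduct_eq_cupProduct_cupProduct (show 2 * (g + p) + 2 * q = 2 * n by omega) G a w]
        exact hwV _ (Submodule.mem_map_of_mem ha)
      change cupProduct _ (cupProduct _ G x) w = 0
      rw [cupProduct_cupProduct_eq_cupProduct_cupProduct (show 2 * (g + p) + 2 * q = 2 * n by omega) G x w, hGw, map_zero]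
  obtain ⟨x', hx', hLx'⟩ := Submodule.mem_map.1 hmem
  exact ⟨x', hx', hLx'⟩

/-- **`N^{p+g}(X) ∩ (G ∪ H^{2p}(X)) = G ∪ N^p(X)`** under the two hypotheses: a `G`-multiple is algebraic iff it is the `G`-multiple
of an algebraic class. [cite: Kleiman1968AlgebraicCycles, §3 (D(X))] [cite: Grothendieck1968, §3 p. 196] -/
theorem cupProduct_mem_algebraicClasses_iff_of_nondegenerate (hX : IsSmoothProjective n X) {g p q : ℕ} (hpgq : p + g + q = n)
    {G : complexBetti X (2 * g)} (hG : G ∈ algebraicClasses X g)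
    (hNum₁ : ∀ w ∈ algebraicClasses X q,
      (∀ a ∈ algebraicClasses X p, cupProduct (show 2 * p + 2 * (g + q) = 2 * n by omega) a
          (cupProduct (show 2 * g + 2 * q = 2 * (g + q) by omega) G w) = 0) →
        cupProduct (show 2 * g + 2 * q = 2 * (g + q) by omega) G w = 0)
    (hNum₂ : ∀ x : complexBetti X (2 * p),
      cupProduct (show 2 * g + 2 * p = 2 * (g + p) by omega) G x ∈ algebraicClasses X (g + p) →
      (∀ w ∈ algebraicClasses X q, cupProduct (show 2 * (g + p) + 2 * q = 2 * n by omega)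
          (cupProduct (show 2 * g + 2 * p = 2 * (g + p) by omega) G x) w = 0) →
        cupProduct (show 2 * g + 2 * p = 2 * (g + p) by omega) G x = 0)
    (x : complexBetti X (2 * p)) :
    cupProduct (show 2 * g + 2 * p = 2 * (g + p) by omega) G x ∈ algebraicClasses X (g + p) ↔
      ∃ x' ∈ algebraicClasses X p, cupProduct (show 2 * g + 2 * p = 2 * (g + p) by omega) G x' =
        cupProduct (show 2 * g + 2 * p = 2 * (g + p) by omega) G x := by
  refine ⟨fun hx ↦ exists_mem_algebraicClasses_cupProduct_eq_of_nondegenerate hX hpgq hG hNum₁ hNum₂ hx, ?_⟩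
  rintro ⟨x', hx', h⟩
  rw [← h]
  exact Voisin2003_cupProduct_algebraicClasses_holds hX hG hx'

/-- **The same from `D(X)` in the two full bidegrees** (right kernel of `(p, g+q)`, left kernel of `(p+g, q)`).
[cite: Kleiman1968AlgebraicCycles, §3 (D(X))] -/
theorem exists_mem_algebraicClasses_cupProduct_eq_of_nondegenerate' (hX : IsSmoothProjective n X) {g p q : ℕ}
    (hpgq : p + g + q = n) {G : complexBetti X (2 * g)} (hG : G ∈ algebraicClasses X g)
    (hD₁ : ∀ b ∈ algebraicClasses X (g + q),
      (∀ a ∈ algebraicClasses X p, cupProduct (show 2 * p + 2 * (g + q) = 2 * n by omega) a b = 0) → b = 0)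
    (hD₂ : ∀ a ∈ algebraicClasses X (g + p),
      (∀ b ∈ algebraicClasses X q, cupProduct (show 2 * (g + p) + 2 * q = 2 * n by omega) a b = 0) → a = 0)
    {x : complexBetti X (2 * p)}
    (hx : cupProduct (show 2 * g + 2 * p = 2 * (g + p) by omega) G x ∈ algebraicClasses X (g + p)) :
    ∃ x' ∈ algebraicClasses X p, cupProduct (show 2 * g + 2 * p = 2 * (g + p) by omega) G x' =
      cupProduct (show 2 * g + 2 * p = 2 * (g + p) by omega) G x :=
  exists_mem_algebraicClasses_cupProduct_eq_of_nondegenerate hX hpgq hG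
    (fun _ hw h ↦ hD₁ _ (Voisin2003_cupProduct_algebraicClasses_holds hX hG hw) h) (fun _ hx' h ↦ hD₂ _ hx' h) hx

end Absolute

/-! ## §2 Compact abelian pencils: the idempotent package is division plus algebraicity of all fibre-class multiples -/

section Pencil

variable {𝒳 S : SchemeOver ℂ} {d : ℕ} {f : 𝒳 ⟶ S}

/-- The display-only bracket of part XXIX-c (re-declared locally; notation, census-invisible). [cite: Grothendieck1968, §3 p. 196 (A(X, L))]
[cite: Abdulali1994FamiliesAV, Conjecture 5.3 (p. 1130)] -/
local notation3 "Div[" hf ", " t ", " p "]" =>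
  Submodule.comap ((fiberGysin hf t p) ∘ₗ (complexBetti.map (fiberι f t) (2 * p)).hom) (algebraicClasses 𝒳 (p + 1)) ≤
    algebraicClasses 𝒳 p ⊔ LinearMap.ker (complexBetti.map (fiberι f t) (2 * p)).hom

/-- **(N_p f)(t) ⟺ Div[t, p] ∧ `L_t H^{2p}(𝒳) ⊆ N^{p+1}(𝒳)`**: part XIV-f's "every invariant class of degree `2p` lifts to an
algebraic class" (= the idempotent package at `(t, 2p)`, part XXVIII-d) is EXACTLY division by the fibre class together with
"every fibre-class multiple `x ∪ [𝒳_t]` is algebraic". So, granted (Div), the habitat clause of part XXVIII reads on the TOTAL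
SPACE: `[𝒳_t] ∪ H^{2p}(𝒳(ℂ); ℂ) ⊆ N^{p+1}(𝒳)`. [cite: Abdulali1994FamiliesAV, Theorem 5.5 (p. 1130)] [cite: Milne2020HodgeClassesAV, Prop. 1 (p. 7)] -/
theorem algebraicInvariantClassesAt_iff_fibreClassDivisionAt_and_range_le (hf : IsCompactAbelianPencil f d)
    (t : ComplexPoints S) (p : ℕ) :
    AlgebraicInvariantClassesAt hf t p ↔ (Div[hf, t, p] ∧
      LinearMap.range ((fiberGysin hf t p) ∘ₗ (complexBetti.map (fiberι f t) (2 * p)).hom) ≤ algebraicClasses 𝒳 (p + 1)) := by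
  refine ⟨fun h ↦ ⟨fibreClassDivisionAt_of_algebraicInvariantClassesAt hf h, ?_⟩, fun ⟨hDiv, hR⟩ x ↦ ?_⟩
  · rintro _ ⟨x, rfl⟩
    obtain ⟨D, hD, hDx⟩ := h x
    change fiberGysin hf t p (complexBetti.map (fiberι f t) (2 * p) x) ∈ algebraicClasses 𝒳 (p + 1)
    rw [← hDx]
    exact fiberGysin_mem_algebraicClasses hf t (algebraicClasses_sup_ker_le_comap hf p t (Submodule.mem_sup_left hD))
  · have hx : x ∈ Submodule.comap ((fiberGysin hf t p) ∘ₗ (complexBetti.map (fiberι f t) (2 * p)).hom)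
        (algebraicClasses 𝒳 (p + 1)) := hR (LinearMap.mem_range_self _ x)
    obtain ⟨D, hD, k, hk, hDk⟩ := Submodule.mem_sup.1 (hDiv hx)
    refine ⟨D, hD, ?_⟩
    have hk' : complexBetti.map (fiberι f t) (2 * p) k = 0 := LinearMap.mem_ker.1 hk
    rw [← hDk, map_add, hk', add_zero]

/-- **(N_p f)(t) ⟺ `L_t H^{2p}(𝒳) ⊆ L_t N^p(𝒳)`** (all fibre-class multiples are fibre-class multiples of algebraic classes).
[cite: Abdulali1994FamiliesAV, Theorem 5.5 (p. 1130)] -/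
theorem algebraicInvariantClassesAt_iff_range_le_map_fiberGysin (hf : IsCompactAbelianPencil f d) (t : ComplexPoints S) (p : ℕ) :
    AlgebraicInvariantClassesAt hf t p ↔
      LinearMap.range ((fiberGysin hf t p) ∘ₗ (complexBetti.map (fiberι f t) (2 * p)).hom) ≤
        (algebraicClasses 𝒳 p).map ((fiberGysin hf t p) ∘ₗ (complexBetti.map (fiberι f t) (2 * p)).hom) := by
  refine ⟨fun h ↦ ?_, fun h x ↦ ?_⟩
  · rintro _ ⟨x, rfl⟩
    obtain ⟨D, hD, hDx⟩ := h x
    refine Submodule.mem_map.2 ⟨D, hD, ?_⟩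
    change fiberGysin hf t p (complexBetti.map (fiberι f t) (2 * p) D) = fiberGysin hf t p (complexBetti.map (fiberι f t) (2 * p) x)
    rw [hDx]
  · obtain ⟨D, hD, hDx⟩ := Submodule.mem_map.1 (h (LinearMap.mem_range_self _ x))
    refine ⟨D, hD, ?_⟩
    have h0 : fiberGysin hf t p (complexBetti.map (fiberι f t) (2 * p) (D - x)) = 0 := by
      rw [map_sub, map_sub, sub_eq_zero]
      exact hDx
    have hk := fibreGysinKernelOn_holds hf p t t (D - x) h0
    rwa [map_sub, sub_eq_zero] at hk

end Pencil

/-! ## §3 Every smooth projective family: the variational statement for algebraic classes, packaged -/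

section Family

variable {𝒳 S : SchemeOver ℂ} {n m : ℕ} {f : 𝒳 ⟶ S}

/-- **A lift at `t` makes a class algebraic on `𝒳_t` algebraic on EVERY fibre**: if `(j_t^*)⁻¹ N^p(𝒳_t) ≤ N^p(𝒳) + ker j_t^*` then
for every global `W` with `j_t^* W` algebraic and every point `s`, `j_s^* W` is algebraic (`W = x + k`, `x` algebraic, `j_t^* k = 0`
hence `j_s^* k = 0` by Deligne's kernel identity; pull-back of algebraic classes is algebraic). [cite: Andre1996Motifs, §5.1 (p. 25)]
[cite: DeligneHodgeII1971, Thm. 4.1.1] -/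
theorem map_fiberι_mem_algebraicClasses_of_comap_le_sup_family (hS : IsSmoothProjective m S) (hf : IsSmoothProjectiveFamily f n)
    (h𝒳 : IsSmoothProjective (n + m) 𝒳) {t : ComplexPoints S} {p : ℕ}
    (hL : (algebraicClasses (fiberOver f t) p).comap (complexBetti.map (fiberι f t) (2 * p)).hom ≤
      algebraicClasses 𝒳 p ⊔ LinearMap.ker (complexBetti.map (fiberι f t) (2 * p)).hom)
    {W : complexBetti 𝒳 (2 * p)} (hW : complexBetti.map (fiberι f t) (2 * p) W ∈ algebraicClasses (fiberOver f t) p)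
    (s : ComplexPoints S) : complexBetti.map (fiberι f s) (2 * p) W ∈ algebraicClasses (fiberOver f s) p := by
  obtain ⟨x, hx, k, hk, hxk⟩ := Submodule.mem_sup.1 (hL hW)
  have hk' : complexBetti.map (fiberι f t) (2 * p) k = 0 := LinearMap.mem_ker.1 hk
  have hks : complexBetti.map (fiberι f s) (2 * p) k = 0 :=
    restrict_eq_zero_of_complexGysin_eq_zero hS hf h𝒳 (show 2 * p + 2 * (n + m) = 2 * (p + m) + 2 * n by omega) t s k
      (by rw [hk', map_zero])
  rw [← hxk, map_add, hks, add_zero]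
  exact fulton1998_map_mem_algebraicClasses_holds (fiberι f s) h𝒳 (hf.isSmoothProjective s) p x hx

/-- **THE VARIATIONAL STATEMENT FOR ALGEBRAIC CLASSES FROM `A(𝒳, η)` OF THE TOTAL SPACE ALONE — EVERY SMOOTH PROJECTIVE FAMILY**:
for `f : 𝒳 ⟶ S` smooth projective of relative dimension `n` over a smooth projective base of dimension `m` with smooth projective
total space satisfying Grothendieck's `A(𝒳, η)` for every polarisation, a class of `H^{2p}(𝒳(ℂ); ℂ)` algebraic on ONE fibre is
algebraic on EVERY fibre (any fibres; no hypothesis on `D(𝒳_t)`). [cite: Grothendieck1968, §3 p. 196] [cite: Andre1996Motifs, Thm. 0.5]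
[cite: Kleiman1968AlgebraicCycles, §3 Cor. 3.9] -/
theorem map_fiberι_mem_algebraicClasses_of_standardConjectureA_family (hS : IsSmoothProjective m S)
    (hf : IsSmoothProjectiveFamily f n) (h𝒳 : IsSmoothProjective (n + m) 𝒳)
    (hA : ∀ η : complexBetti 𝒳 2, IsPolarizationClass (n + m) 𝒳 η → StandardConjectureA (n + m) 𝒳 η)
    {t : ComplexPoints S} {p : ℕ} {W : complexBetti 𝒳 (2 * p)}
    (hW : complexBetti.map (fiberι f t) (2 * p) W ∈ algebraicClasses (fiberOver f t) p) (s : ComplexPoints S) :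
    complexBetti.map (fiberι f s) (2 * p) W ∈ algebraicClasses (fiberOver f s) p :=
  map_fiberι_mem_algebraicClasses_of_comap_le_sup_family hS hf h𝒳 (comap_le_sup_of_standardConjectureA_family hS hf h𝒳 hA p t)
    hW s

/-- **Unconditionally for families of curves, surfaces or threefolds over a smooth projective curve**: a global class algebraic on
one fibre is algebraic on every fibre (part XXIX-d). [cite: Lieberman1968, Thm. 1] [cite: Andre1996Motifs, Thm. 0.5] -/
theorem map_fiberι_mem_algebraicClasses_of_curveBase_of_relDim_le_three (hS : IsSmoothProjective 1 S)
    (hf : IsSmoothProjectiveFamily f n) (hn : n ≤ 3) (h𝒳 : IsSmoothProjective (n + 1) 𝒳) {t : ComplexPoints S} {p : ℕ}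
    {W : complexBetti 𝒳 (2 * p)} (hW : complexBetti.map (fiberι f t) (2 * p) W ∈ algebraicClasses (fiberOver f t) p)
    (s : ComplexPoints S) : complexBetti.map (fiberι f s) (2 * p) W ∈ algebraicClasses (fiberOver f s) p :=
  map_fiberι_mem_algebraicClasses_of_comap_le_sup_family hS hf h𝒳 (comap_le_sup_of_curveBase_of_relDim_le_three hS hf hn h𝒳 p t)
    hW s

end Family

end Summit.HodgeConjecture.HodgeConjecture.Ring2.AbelianAll

end
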